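import Literature.Probability.RandomPlanarGeometry.SLESameSideLaw
import Literature.Probability.RandomPlanarGeometry.RohdeSchrammCor35Proofs
import HarnessLib

/-!
# Rohde–Schramm's Lemma 6.6, eq. (6.13) (the named fact, discharged)

Topic `Probability/RandomPlanarGeometry`; theorems only (no definition, no new named fact); proof
sibling of `CritPercSLESwallowing.lean`. We **discharge** the named fact
`Literature.Probability.RandomPlanarGeometry.sle_measureReal_Ico_disjoint_range_eq` — S. Rohde,
O. Schramm, *Basic properties of SLE*, Ann. of Math. 161 (2005), **Lemma 6.6** (p. 908): for
`κ ∈ (4, 8)` and `X := inf([1, ∞) ∩ γ[0, ∞))`, for all `s ≥ 1`,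
`P[X ≥ s] = 4^{(κ-4)/κ} √π ₂F₁(1 - 4/κ, 2 - 8/κ, 2 - 4/κ, 1/s) s^{(4-κ)/κ} / (Γ(2 - 4/κ) Γ(4/κ - 1/2))`
(eq. (6.13)).

The whole route is in the tree:

* `SLESameSideLaw.lean` — the sharp two-point swallowing law `P[T₁ = T_s] = RHS (6.13)` for
  `4 < κ < 8`, `s ≥ 1` (`measureReal_swallowingTime_one_eq_rohdeSchramm613`: the printed proof's
  local martingale `h(1/Yₜ)`, optional sampling, the energy estimate excluding `{T₁ = T_s}` off the
  hitting event, and the hypergeometric identities of `SameSideHypergeometric.lean` /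
  `GaussIncompleteBeta.lean` identifying `(h(z₀) - h(1))/(h(∞) - h(1))` with the right-hand side
  of (6.13));
* `CritPercSLESwallowingLaw.lean` — on the event that the chain is generated by a curve,
  `[1, s) ∩ γ[0, ∞) = ∅ ↔ T₁ = T_s` (`IsGeneratedByCurve.forall_notMem_range_iff_swallowingTime_eq`),
  whence the vendored statement is **equivalent** to trace existence on `(4, 8)`
  (`sle_measureReal_Ico_disjoint_range_eq_iff_hasSLETrace`; the junk trace `0` makes the event sure
  on the complement, while RHS (6.13) `→ 0` as `s → ∞`);
* `RohdeSchrammCor35Proofs.lean` — Rohde–Schramm's trace theorem Thm. 5.1 for `κ ≠ 8`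
  (`hasSLETrace_of_ne_eight_holds`, from the derivative estimate Cor. 3.5,
  `RohdeSchramm2005_cor35_holds`, Thm. 3.6 and the deterministic criterion Thm. 4.1).

## References

* S. Rohde, O. Schramm, *Basic properties of SLE*, Ann. of Math. 161 (2005) 883–924
  (arXiv:math/0106036): Lemma 6.6 and eq. (6.13) (p. 908), Thm. 5.1, Cor. 3.5.
-/

noncomputable section

open scoped NNReal

namespace Literature.Probability.RandomPlanarGeometry

/-- **Rohde–Schramm (2005), Lemma 6.6 (eq. (6.13)) holds**: for `κ ∈ (4, 8)` and every `s ≥ 1`,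
the probability that no real `y ∈ [1, s)` lies on the SLE_κ trace equals
`4^{(κ-4)/κ} √π ₂F₁(1 - 4/κ, 2 - 8/κ; 2 - 4/κ; 1/s) s^{(4-κ)/κ} / (Γ(2 - 4/κ) Γ(4/κ - 1/2))`.
The named fact `sle_measureReal_Ico_disjoint_range_eq` of `CritPercSLESwallowing.lean`, discharged:
the two-point law and the event identification (`sle_measureReal_Ico_disjoint_range_eq_of_hasSLETrace_of_ne_eight`,
`SLESameSideLaw.lean`) fed with the trace theorem Thm. 5.1 (`hasSLETrace_of_ne_eight_holds`,
`RohdeSchrammCor35Proofs.lean`). [cite: RohdeSchramm2005, Lemma 6.6, eq. (6.13) (p. 908)] -/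
theorem sle_measureReal_Ico_disjoint_range_eq_holds : sle_measureReal_Ico_disjoint_range_eq :=
  sle_measureReal_Ico_disjoint_range_eq_of_hasSLETrace_of_ne_eight hasSLETrace_of_ne_eight_holds

/-- **Lemma 6.6 pointwise** (convenience restatement of the discharged fact with explicit
arguments). [cite: RohdeSchramm2005, Lemma 6.6, eq. (6.13)] -/
theorem sle_measureReal_Ico_disjoint_range_eq_apply {κ : ℝ≥0} (hκ : 4 < κ) (hκ' : κ < 8) {s : ℝ}
    (hs : 1 ≤ s) :
    Process.preWienerMeasure.real
        {ω | ∀ y : ℝ, 1 ≤ y → y < s → (y : ℂ) ∉ Set.range (sleTrace κ ω)} =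
      (4 : ℝ) ^ (((κ : ℝ) - 4) / κ) * Real.sqrt Real.pi *
          ₂F₁ (1 - 4 / (κ : ℝ)) (2 - 8 / (κ : ℝ)) (2 - 4 / (κ : ℝ)) (1 / s) *
          s ^ ((4 - (κ : ℝ)) / κ) /
        (Real.Gamma (2 - 4 / (κ : ℝ)) * Real.Gamma (4 / (κ : ℝ) - 1 / 2)) :=
  sle_measureReal_Ico_disjoint_range_eq_holds hκ hκ' hs

end Literature.Probability.RandomPlanarGeometry
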